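import Summits.CriticalPhenomena.PercolationContinuityZ3.Theorems.PercNearOneGluingNoHeavyQuantFarCycleBlockDecouple
import HarnessLib

/-!
# QUANT lane R8, front "FAR beyond trees", layer one — PENDANT CYCLE BLOCKS VI: the STEM COUNT of the hub-decoupled block and its laws
# (`P_{w'}(X ≥ 1) = hProd`, `P_{w'}(X ≥ 2) = tProd`)

builds on p205010 (kernel theorem, internal audit signed; external expert review pending)

Support file (`--supports stmt-CriticalPhenomena-4575`), seat `prim-quant-p1` (gen 22); memo
`run/shared/lean/prim/quant/prim-quant-p1-g22/FOR-LEAD-KHUB.md` §4.  Standard axioms; no sorries.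

Under the hub-decoupled weights `w' = Block.cdecouple …` (`…QuantFarCycleBlockDecouple`) the block count is the stem count
`Σ_j 𝟙[stem j open]·W_j`; over a list `ps` of positions this is `Block.stemCountL … ps` (`Block.stemCount_eq_stemCountL`: the loaded positions
suffice).  The stems are independent `Bern(m_j)` pairs, independent of the hubs, so peeling one stem-and-hub at a time gives the independent-sum
recursion of `…QuantFarDecLawDefs`:
* **`Block.real_stemCountL`** — `P_{w'}(stemCountL ps ≥ 1) = hProd |ps| C` and `P_{w'}(stemCountL ps ≥ 2) = tProd |ps| C`, `C = chainOf … w pre ps`.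
[cite: Grimmett1999, §1.3 p. 10; §2.2]; bookkeeping [this work].
-/

noncomputable section

namespace Summit.CriticalPhenomena.PercolationContinuityZ3.Theorems

namespace Quant

namespace Block

open Finset MeasureTheory Set
open Literature.Probability.LatticeModels
open Literature.Probability.Percolation
open TwoChain (hProd tProd)
open scoped Classical

variable {n : ℕ}

/-! ## The stem count over a list -/

/-- The same over a list of positions. [this work] -/
def stemCountL (cyc : ℕ → Fin n) (S : ℕ → Finset (Fin n)) (A : Finset (Fin n)) (qs : List ℕ) (ω : BondConfig (Fin n)) : ℕ :=
  (qs.map fun p => if s(cyc 0, cyc p) ∈ ω then hubCount cyc S A p ω else 0).sum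

/-- The stems of a list of positions. [this work] -/
def stemSet (cyc : ℕ → Fin n) : List ℕ → Finset (Sym2 (Fin n))
  | [] => ∅
  | p :: qs => {s(cyc 0, cyc p)} ∪ stemSet cyc qs

/-- [this work] -/ @[simp] theorem stemCountL_nil (cyc : ℕ → Fin n) (S : ℕ → Finset (Fin n)) (A : Finset (Fin n)) (ω : BondConfig (Fin n)) :
    stemCountL cyc S A [] ω = 0 := rfl
/-- [this work] -/ @[simp] theorem stemCountL_cons (cyc : ℕ → Fin n) (S : ℕ → Finset (Fin n)) (A : Finset (Fin n)) (p : ℕ) (qs : List ℕ)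
    (ω : BondConfig (Fin n)) :
    stemCountL cyc S A (p :: qs) ω = (if s(cyc 0, cyc p) ∈ ω then hubCount cyc S A p ω else 0) + stemCountL cyc S A qs ω := by simp [stemCountL]
/-- [this work] -/ @[simp] theorem stemSet_nil (cyc : ℕ → Fin n) : stemSet cyc [] = ∅ := rfl
/-- [this work] -/ @[simp] theorem stemSet_cons (cyc : ℕ → Fin n) (p : ℕ) (qs : List ℕ) :
    stemSet cyc (p :: qs) = {s(cyc 0, cyc p)} ∪ stemSet cyc qs := rfl

/-- Membership in `stemSet`. [this work] -/
theorem mem_stemSet (cyc : ℕ → Fin n) {qs : List ℕ} {e : Sym2 (Fin n)} : e ∈ stemSet cyc qs ↔ ∃ p ∈ qs, e = s(cyc 0, cyc p) := by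
  induction qs with
  | nil => simp
  | cons p qs ih => simp [ih]

/-- `stemCountL` is read off the stems and hub pairs of the listed positions. [this work] -/
theorem readsOff_stemCountL (cyc : ℕ → Fin n) (S : ℕ → Finset (Fin n)) (A : Finset (Fin n)) (qs : List ℕ) :
    ReadsOff (stemCountL cyc S A qs) (↑(stemSet cyc qs ∪ hubPairsL cyc S qs)) := by
  induction qs with
  | nil => intro ω ω' _; rfl
  | cons p qs ih =>
    have h1 : ReadsOff (fun ω => if s(cyc 0, cyc p) ∈ ω then hubCount cyc S A p ω else 0)
        (↑({s(cyc 0, cyc p)} : Finset (Sym2 (Fin n))) ∪ ↑(hubPairs (S p) (cyc p))) :=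
      (readsOff_mem s(cyc 0, cyc p)).map₂ (readsOff_hubCount cyc S A p) fun (c : Prop) (k : ℕ) => if c then k else 0
    have h := h1.map₂ ih (· + ·)
    intro ω ω' hF
    rw [stemCountL_cons, stemCountL_cons]
    refine h ω ω' ?_
    have hset : (↑({s(cyc 0, cyc p)} : Finset (Sym2 (Fin n))) ∪ ↑(hubPairs (S p) (cyc p))) ∪ ↑(stemSet cyc qs ∪ hubPairsL cyc S qs) =
        (↑(stemSet cyc (p :: qs) ∪ hubPairsL cyc S (p :: qs)) : Set (Sym2 (Fin n))) := by
      simp only [stemSet_cons, hubPairsL_cons, Finset.coe_union]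
      ext e; simp only [Set.mem_union]; tauto
    rw [hset]; exact hF


section CycleBlock

variable {L : ℕ} {cyc : ℕ → Fin n} {S : ℕ → Finset (Fin n)} {Z : Finset (Fin n)} (H : IsCycleBlock L cyc S Z)
  (w : Sym2 (Fin n) → unitInterval)
include H

omit H in
/-- The stem count over all positions is the stem count over the loaded positions. [this work] -/
theorem stemCount_eq_stemCountL (A : Finset (Fin n)) (ω : BondConfig (Fin n)) :
    stemCount L cyc S A ω = stemCountL cyc S A (loadedList L cyc S A) ω := by
  unfold stemCount stemCountL
  have hnd : (loadedList L cyc S A).Nodup := (loadedList_sorted L cyc S A).imp ne_of_lt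
  rw [← List.sum_toFinset _ hnd]
  symm
  apply Finset.sum_subset
  · intro j hj
    rw [List.mem_toFinset, mem_loadedList] at hj
    exact mem_cpos.2 ⟨hj.2.1, hj.1⟩
  · intro j hj hjn
    rw [List.mem_toFinset, mem_loadedList] at hjn
    have hnl : ¬ Loaded cyc S A j := fun h => hjn ⟨(mem_cpos.1 hj).2, (mem_cpos.1 hj).1, h⟩
    simp [hubCount_eq_zero_of_not_loaded cyc S A hnl ω]

/-- The stems of distinct listed positions and their hub pairs avoid a further position's stem and hub pairs. [this work] -/
theorem disjoint_stem_hub_rest {p : ℕ} {qs : List ℕ} (hp : 1 ≤ p ∧ p < L) (hqs : ∀ q ∈ qs, 1 ≤ q ∧ q < L) (hpq : p ∉ qs) :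
    Disjoint ({s(cyc 0, cyc p)} ∪ hubPairs (S p) (cyc p)) (stemSet cyc qs ∪ hubPairsL cyc S qs) := by
  rw [Finset.disjoint_union_left, Finset.disjoint_union_right, Finset.disjoint_union_right]
  refine ⟨⟨?_, ?_⟩, ?_, disjoint_hubPairs_hubPairsL H hp hqs hpq⟩
  · rw [Finset.disjoint_singleton_left, mem_stemSet]
    rintro ⟨q, hq, h⟩
    exact hpq (stem_index_unique H hp (hqs q hq) h ▸ hq)
  · rw [Finset.disjoint_singleton_left, mem_hubPairsL]
    rintro ⟨q, hq, h⟩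
    exact stem_notMem_hubPairs H hp.2 (hqs q hq) h
  · rw [Finset.disjoint_left]
    intro e he he'
    obtain ⟨q, hq, rfl⟩ := (mem_stemSet cyc).1 he'
    exact stem_notMem_hubPairs H (hqs q hq).2 hp he

/-- **`P_{w'}(stemCountL ps ≥ 1) = hProd |ps| C` and `P_{w'}(stemCountL ps ≥ 2) = tProd |ps| C`** (`C = chainOf … w pre ps`). [this work] -/
theorem real_stemCountL (hw : CycleHang L cyc S Z w) (A : Finset (Fin n)) :
    ∀ (ps : List ℕ) (pre : ℕ), (∀ p ∈ ps, 1 ≤ p ∧ p < L) → ps.Nodup →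
      (prodBernoulli (cdecouple L cyc S Z w)).real {ω | 1 ≤ stemCountL cyc S A ps ω} = hProd ps.length (chainOf L cyc S A w pre ps) ∧
      (prodBernoulli (cdecouple L cyc S Z w)).real {ω | 2 ≤ stemCountL cyc S A ps ω} = tProd ps.length (chainOf L cyc S A w pre ps) := by
  have hmeas : ∀ U : Set (BondConfig (Fin n)), MeasurableSet U := fun U => (Set.toFinite U).measurableSet
  set w' := cdecouple L cyc S Z w with hw'
  intro ps
  induction ps with
  | nil =>
    intro pre _ _
    simp only [stemCountL_nil, List.length_nil, TwoChain.hProd_zero, TwoChain.tProd_zero]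
    exact ⟨by simp, by simp⟩
  | cons p ps ih =>
    intro pre hps hnd
    have hp : 1 ≤ p ∧ p < L := hps p (by simp)
    have hps' : ∀ q ∈ ps, 1 ≤ q ∧ q < L := fun q hq => hps q (by simp [hq])
    have hpps : p ∉ ps := (List.nodup_cons.1 hnd).1
    obtain ⟨ih1, ih2⟩ := ih p hps' (List.nodup_cons.1 hnd).2
    rw [List.length_cons, TwoChain.hProd_succ, TwoChain.tProd_succ, chainOf_shift]
    simp only [stemCountL_cons]
    -- the statistic of hub `p` with its stem
    set V : BondConfig (Fin n) → ℕ := fun ω => if s(cyc 0, cyc p) ∈ ω then hubCount cyc S A p ω else 0 with hV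
    have dV : ∀ P : ℕ → Prop, DeterminedBy {ω | P (V ω)} (↑({s(cyc 0, cyc p)} ∪ hubPairs (S p) (cyc p)) : Set (Sym2 (Fin n))) := by
      intro P
      have h := ((readsOff_mem s(cyc 0, cyc p)).map₂ (readsOff_hubCount cyc S A p) fun (c : Prop) (k : ℕ) => if c then k else 0).determinedBy P
      rw [Finset.coe_union]; exact h
    have dR : ∀ Q : ℕ → Prop, DeterminedBy {ω | Q (stemCountL cyc S A ps ω)} (↑(stemSet cyc ps ∪ hubPairsL cyc S ps) : Set (Sym2 (Fin n))) :=
      fun Q => (readsOff_stemCountL cyc S A ps).determinedBy Q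
    have indep : ∀ (P Q : ℕ → Prop), (prodBernoulli w').real ({ω | P (V ω)} ∩ {ω | Q (stemCountL cyc S A ps ω)}) =
        (prodBernoulli w').real {ω | P (V ω)} * (prodBernoulli w').real {ω | Q (stemCountL cyc S A ps ω)} :=
      fun P Q => prodBernoulli_real_inter_of_determinedBy_disjoint w' (disjoint_stem_hub_rest H hp hps' hpps) (dV P) (dR Q) (hmeas _) (hmeas _)
    -- the law of `V`: stem and hub are independent
    have dS : DeterminedBy {ω : BondConfig (Fin n) | s(cyc 0, cyc p) ∈ ω} (↑({s(cyc 0, cyc p)} : Finset (Sym2 (Fin n))) : Set (Sym2 (Fin n))) :=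
      (readsOff_mem s(cyc 0, cyc p)).determinedBy id
    have dW : ∀ P : ℕ → Prop, DeterminedBy {ω | P (hubCount cyc S A p ω)} (↑(hubPairs (S p) (cyc p)) : Set (Sym2 (Fin n))) :=
      fun P => (readsOff_hubCount cyc S A p).determinedBy P
    have hdSW : Disjoint ({s(cyc 0, cyc p)} : Finset (Sym2 (Fin n))) (hubPairs (S p) (cyc p)) := by
      rw [Finset.disjoint_singleton_left]; exact stem_notMem_hubPairs H hp.2 hp
    set m := cwProb L cyc w p + ccwProb L cyc w p - cwProb L cyc w p * ccwProb L cyc w p with hm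
    have lawV : ∀ P : ℕ → Prop, (prodBernoulli w').real ({ω | s(cyc 0, cyc p) ∈ ω} ∩ {ω | P (hubCount cyc S A p ω)}) =
        m * (prodBernoulli w).real {ω | P (hubCount cyc S A p ω)} := by
      intro P
      rw [prodBernoulli_real_inter_of_determinedBy_disjoint w' hdSW dS (dW P) (hmeas _) (hmeas _), real_stem_open H w hw hp,
        real_hub_cdecouple H w A hp]
    have hV1 : ∀ k, 1 ≤ k → {ω | k ≤ V ω} = {ω | s(cyc 0, cyc p) ∈ ω} ∩ {ω | k ≤ hubCount cyc S A p ω} := by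
      intro k hk; ext ω; simp only [hV, mem_setOf_eq, Set.mem_inter_iff]
      by_cases h : s(cyc 0, cyc p) ∈ ω
      · simp [h]
      · simp only [h, if_false, false_and, iff_false, not_le]; omega
    have hVeq1 : {ω | V ω = 1} = {ω | s(cyc 0, cyc p) ∈ ω} ∩ {ω | hubCount cyc S A p ω = 1} := by
      ext ω; simp only [hV, mem_setOf_eq, Set.mem_inter_iff]
      by_cases h : s(cyc 0, cyc p) ∈ ω
      · simp [h]
      · simp [h]
    have hV0 : (prodBernoulli w').real {ω | V ω = 0} = 1 - m * (hs cyc S A w p + hd cyc S A w p) := by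
      have : {ω | V ω = 0} = {ω | 1 ≤ V ω}ᶜ := by ext ω; simp only [mem_setOf_eq, Set.mem_compl_iff]; omega
      rw [this, probReal_compl_eq_one_sub (hmeas _), hV1 1 le_rfl, lawV (fun k => 1 ≤ k), real_hubCount_ge_one]
    have hm1 : (chainOf L cyc S A w pre (p :: ps)).m 1 = m := by simp [TwoChain.m, chainOf, hm]
    have hu1 : (chainOf L cyc S A w pre (p :: ps)).u 1 = hs cyc S A w p + hd cyc S A w p := by simp [TwoChain.u, chainOf]
    have hs1 : (chainOf L cyc S A w pre (p :: ps)).s 1 = hs cyc S A w p := by simp [chainOf]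
    have hd1 : (chainOf L cyc S A w pre (p :: ps)).d 1 = hd cyc S A w p := by simp [chainOf]
    constructor
    · have e : {ω : BondConfig (Fin n) | 1 ≤ V ω + stemCountL cyc S A ps ω} =
          {ω | 1 ≤ V ω} ∪ ({ω | V ω = 0} ∩ {ω | 1 ≤ stemCountL cyc S A ps ω}) := by
        ext ω; simp only [mem_setOf_eq, Set.mem_union, Set.mem_inter_iff]; omega
      have hd : Disjoint {ω : BondConfig (Fin n) | 1 ≤ V ω} ({ω | V ω = 0} ∩ {ω | 1 ≤ stemCountL cyc S A ps ω}) := by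
        rw [Set.disjoint_left]; rintro ω h1 ⟨h0, -⟩; simp only [mem_setOf_eq] at h1 h0; omega
      rw [e, measureReal_union hd (hmeas _), indep (fun k => k = 0) (fun k => 1 ≤ k), ih1, hV0, hV1 1 le_rfl, lawV (fun k => 1 ≤ k),
        real_hubCount_ge_one, hm1, hu1]
    · have e : {ω : BondConfig (Fin n) | 2 ≤ V ω + stemCountL cyc S A ps ω} =
          ({ω | 2 ≤ V ω} ∪ ({ω | V ω = 1} ∩ {ω | 1 ≤ stemCountL cyc S A ps ω})) ∪ ({ω | V ω = 0} ∩ {ω | 2 ≤ stemCountL cyc S A ps ω}) := by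
        ext ω; simp only [mem_setOf_eq, Set.mem_union, Set.mem_inter_iff]; omega
      have hdA : Disjoint {ω : BondConfig (Fin n) | 2 ≤ V ω} ({ω | V ω = 1} ∩ {ω | 1 ≤ stemCountL cyc S A ps ω}) := by
        rw [Set.disjoint_left]; rintro ω h1 ⟨h0, -⟩; simp only [mem_setOf_eq] at h1 h0; omega
      have hdB : Disjoint ({ω : BondConfig (Fin n) | 2 ≤ V ω} ∪ ({ω | V ω = 1} ∩ {ω | 1 ≤ stemCountL cyc S A ps ω}))
          ({ω | V ω = 0} ∩ {ω | 2 ≤ stemCountL cyc S A ps ω}) := by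
        rw [Set.disjoint_left]; rintro ω (h1 | ⟨h1, -⟩) ⟨h0, -⟩ <;> simp only [mem_setOf_eq] at h1 h0 <;> omega
      rw [e, measureReal_union hdB (hmeas _), measureReal_union hdA (hmeas _), indep (fun k => k = 1) (fun k => 1 ≤ k),
        indep (fun k => k = 0) (fun k => 2 ≤ k), ih1, ih2, hV0, hV1 2 (by norm_num), hVeq1, lawV (fun k => 2 ≤ k), lawV (fun k => k = 1),
        hm1, hu1, hs1, hd1]
      unfold hd hs
      ring

end CycleBlock

end Block

end Quant

end Summit.CriticalPhenomena.PercolationContinuityZ3.Theorems
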